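import Mathlib
import HarnessLib
import Literature.Analysis.FluidPDE.ClassicalSolution
import Summits.NavierStokesRegularity.NavierStokesRegularity.Theorems.QuarterLogPincerBeadCensusDefs

/-!
# Route `QuarterLogPincer`, crux `TypeIQuantSubcubicExp` (stmt-NavierStokesRegularity-24077), line `ember_census` —
# the line's OBJECTS, verbatim (Defs file)

VERBATIM port of the statement objects of §E of ns-idea-7's workfile `Cruxes/TypeIQuantSubcubicExp/Lines/ember_census.lean`
(v1.1, 2026-08-29T05:20Z; idea-crit verdicts of record PASS): `Hot`, `Terminal` (hot / terminal events) and E2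
`TerminalEmber`, in the decl-of-record namespace `…Cruxes.TypeIQuantSubcubicExp.EmberCensus` (the same objects are restated
byte-identically in `silencing_cost` and `smooth_silence`, idea-crit-4 g8 07:07Z); the level objects (`levelScale`, …,
`FlarePersistence`) live in their home `…QuarterLogPincerBeadCensusDefs` and are not restated.  Only textual change:
the local notation `E3` is unfolded (no notation declared).  E1 `HotWitness` is deliberately NOT
ported yet (director-ns dss_141 (1) / dss_147 (2): it is being split into `HotWitnessFar` ⊕ `HotWitnessNear` by the line's
custodian; the far half is the tree theorem `EmberCensus.hotWitness_far`, p704006).  No stub is proved here.  HONEST FRAME: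
Props about HYPOTHETICAL Type-I classical solutions; nothing here bears on 24077's truth, W7 or Navier–Stokes regularity (OPEN /
not proved).  pub-ns-dss typer (g38), `--supports stmt-NavierStokesRegularity-24077`; text by ns-idea-7 (g12).
-/

set_option linter.dupNamespace false

namespace Summit.NavierStokesRegularity.NavierStokesRegularity.Cruxes.TypeIQuantSubcubicExp.EmberCensus

noncomputable section

open MeasureTheory Set Function Filter Topology Metric
open scoped ENNReal NNReal Classical
open Literature.Analysis Literature.Analysis.FluidPDE

/-- **HOT EVENT** at `(y,t)` for the virtual blow-up time `T'` (`= T + τ`) and threshold `ε`: the velocity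
at `(y,t)` exceeds `ε` in CLOCK units, `ε < √(T'−t)·‖u(t,y)‖`, and there is parabolic room below it
(`T' − t ≤ t`, so the box `(t − (T'−t), t]` lies in `[0,T]`).  Pointwise and clock-relative ON PURPOSE: on an
«ε-cold» region (`‖u(s,x)‖ ≤ ε(T'−s)^{-1/2}`) the Gustafson–Kang–Tsai `(p,q) = (∞,1)` quantity
`ρ⁻¹ ∫_{t₀−ρ²}^{t₀} sup_{B_ρ} |u| ds ≤ 2ε` at EVERY scale `ρ` — the `L¹`-in-time norm integrates the clock —
so cold regions are quantitatively regular at every scale, not only at the clock scale. -/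
def Hot (ε T' : ℝ) (u : ℝ → (EuclideanSpace ℝ (Fin 3)) → (EuclideanSpace ℝ (Fin 3)))
    (y : (EuclideanSpace ℝ (Fin 3))) (t : ℝ) : Prop :=
  T' - t ≤ t ∧ ε < Real.sqrt (T' - t) * ‖u t y‖

/-- **TERMINAL** hot event (aperture `K`, horizon `t₁`): no hot event FOLLOWS `(y,t)` — at a later time
`≤ t₁`, at clock at most half (`4(T'−t') ≤ T'−t`), within `4K√(T'−t)` of `y`.  The aftermath
`B(y, 4K√(T'−t)) × {t < s ≤ t₁ : 4(T'−s) ≤ T'−t}` of a terminal event is ε-cold. -/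
def Terminal (K ε T' t₁ : ℝ) (u : ℝ → (EuclideanSpace ℝ (Fin 3)) → (EuclideanSpace ℝ (Fin 3)))
    (y : (EuclideanSpace ℝ (Fin 3))) (t : ℝ) : Prop :=
  ∀ (y' : (EuclideanSpace ℝ (Fin 3))) (t' : ℝ), t < t' → t' ≤ t₁ → 4 * (T' - t') ≤ T' - t →
    ‖y' - y‖ ≤ 4 * K * Real.sqrt (T' - t) → ¬ Hot ε T' u y' t'

/-- **E2 — `TerminalEmber` (size L; THE LINE'S LOAD-BEARING LEMMA; no wall; `A`-free): a terminal hot event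
leaves an EMBER.**  There is an absolute `ε₀ > 0` (the ε-regularity regime; v1.1) such that for
`0 < ε ≤ ε₀`, `M ≥ 1` there are an aperture `K = K(ε,M) ≥ 1`, a deposit `c = c(ε,M) > 0` and a room factor
`Λ = Λ(ε,M) ≥ 1`: in the crux frame with virtual rate `M`, an ε-hot event `(y,t)`, `t ≤ t₁ ∈ (0,T]`, with room
`Λ(T'−t) ≤ t` (so that I1 applies at the scales `≤ √Λ·σ` the mechanism uses), that is `K`-terminal up to
`t₁` has `c ≤ ∫_{B(y, K√(T'−t))} |u(t₁)|³`.  Mechanism, `σ := √(T'−t)`: (a) REGULAR BOX — on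
`B(y,(4K−1)σ) × (t−σ², t₁]`, `|u| ≤ M₁(M)/σ` (clock `≥ σ√3/4`: the rate; below: every point is ε-cold by
terminality, and pointwise coldness ⇒ GKT `(∞,1)` smallness at every scale `≤ σ/4` ⇒ with I1 as seed, CKN ⇒
`|u| ≤ C(M)/σ`), derivatives by interior smoothing on `(t−σ²/2, t₁]`; (b) HOT CENTRE IS VORTICAL —
`|u(t,y)| > ε/σ` and `|∇u(t)| ≤ M₁²/σ²` give a blob; were `‖ω(t)‖_{L²(B(y,Γ₂σ))}` below `δ(M)σ^{-1/2}`, `u(t)`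
would be harmonic up to that error on `B(y,Γ₂σ)` and `|u(y)|² ≤ ⨍_{B(y,Γ₂σ)}|u|²` would contradict I1's SLICE
ENERGY `∫_{B(y,ρ)}|u(t)|² ≤ C(M)ρ` at `ρ = Γ₂(M)σ` (STREAM EXCLUSION — by the rate alone, no `A`); (c) COST
OF SILENCING — in a regular box of thickness `Kσ` and time span `≤ 2σ²` the vorticity equation is LINEAR in
`ω` with coefficients `|u| ≤ M₁/σ`, `|∇u| ≤ M₁²/σ²`; driving the centre's enstrophy from `δ` below `c₂` by
time `t₁` requires lateral influence, attenuated by `e^{-cK²}` across the box while the box holds only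
`|ω| ≤ M₁²/σ²`: impossible once `e^{cK²} > M₁² e^{CM₁²}/δ`, i.e. for `K ≥ K(M)` [Carleman / unique
continuation: Tao 2021 Prop. 4.3 (second Carleman inequality) chained over `≤ 10³C₀M₁²` windows,
corpus:paper:tao2021-quantitative-bounds-critically-bounded-solutions-navier-stokes p.32; Escauriaza–Fernández–
Vessella two-sphere one-cylinder / doubling, arXiv:math/0611462 Thm 2–3; Escauriaza–Seregin–Šverák backward
uniqueness class]; pressure does not enter (vorticity formulation); (d) `‖ω(t₁)‖_{L²(B(y,Kσ/2))} ≥ c₂σ^{-1/2}`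
with `|∇ω(t₁)| ≤ M₁³/σ³` yields a point value `≥ c₃/σ²`, hence circulation, hence `|u(t₁)| ≥ c₄/σ` on a ball
of radius `c₅σ`: cube `≥ c(M,ε)`.  Why it might fail: step (c) with coefficient × span `≈ M₁² ≫ 1` is not
verbatim in print — Tao's Prop. 4.3 normalises the coefficients small against the span ((4.4)), so one
chains it over `O(M₁²)` short windows, re-seeding each window by time-continuity in the regular box; the
losses compound to a tower in `M` but stay positive.  A clean «interior cost of null-control for heat with
bounded drift in a thick box» statement is the honest missing lemma — LINEAR and bounded-coefficient (no
Type-I criticality, no small constant): the DSS wall does not reach it.  Killed by: a smooth Type-I family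
with a terminal ε-hot event whose box cube at `t₁` tends to `0` for every fixed `K`. -/
def TerminalEmber : Prop :=
  ∃ ε₀ : ℝ, 0 < ε₀ ∧ ∀ ε M : ℝ, 0 < ε → ε ≤ ε₀ → 1 ≤ M → ∃ K c Λ : ℝ, 1 ≤ K ∧ 0 < c ∧ 1 ≤ Λ ∧
    ∀ (T τ : ℝ) (u : ℝ → (EuclideanSpace ℝ (Fin 3)) → (EuclideanSpace ℝ (Fin 3)))
      (p : ℝ → (EuclideanSpace ℝ (Fin 3)) → ℝ),
      (IsClassicalNSSolutionOn (Icc 0 T) 1 0 u p ∧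
          ∀ m : ℕ, ∃ C : NNReal, ∀ t ∈ Icc 0 T, eLpNorm (iteratedFDeriv ℝ m (u t)) 2 volume ≤ C) →
        0 < τ →
        (∀ t ∈ Icc 0 T, ∀ x : (EuclideanSpace ℝ (Fin 3)), ‖u t x‖ ≤ M * (T + τ - t) ^ (-(1 / 2 : ℝ))) →
        ∀ (t₁ : ℝ) (y : (EuclideanSpace ℝ (Fin 3))) (t : ℝ), t₁ ∈ Ioc 0 T → t ≤ t₁ → Λ * (T + τ - t) ≤ t →
          Hot ε (T + τ) u y t → Terminal K ε (T + τ) t₁ u y t →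
          ENNReal.ofReal c ≤ ∫⁻ x in ball y (K * Real.sqrt (T + τ - t)), ‖u t₁ x‖ₑ ^ (3 : ℝ)

/-! ### v1.2 APPEND (typer g38, after the E1a/E1b split was registered — ember_census v1.2, idea-crit-4 PASS 2026-08-29T08:26Z;
director-ns dss_147 (2)): E1 `HotWitness`, E1a `HotWitnessFar` (= the tree theorem `hotWitness_far`, p704006, as a Prop),
E1b `HotWitnessNear`, E2♭ `TerminalEmberM`, VERBATIM (the level objects via `…BeadCensusDefs`). -/

section SplitV12

open Summit.NavierStokesRegularity.NavierStokesRegularity.Cruxes.TypeIQuantSubcubicExp.BeadCensus (levelScale)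

/-- **E1 — `HotWitness` (size M; PUBLISHED MECHANISMS; no wall; `A`-free).**  For `μ > 0`, `M ≥ 1` and any cap
`ε₀ > 0` there are `0 < ε = ε(μ,M,ε₀) ≤ ε₀` and `Γ = Γ(μ,M,ε₀) ≥ 1` (v1.1: the threshold is produced BELOW
any prescribed cap, so that E2 may restrict to the ε-regularity regime `ε ≤ ε₀`) such that in the crux frame with the virtual Type-I rate `M`: if a
CANDIDATE ANNULUS `{R < |x−x₀| < M^{10μ}R}` of level `k+1` (`4M√s ≤ R`, `M^{10μ}R ≤ e^{a}√s`,
`s = levelScale a t₁ (k+1)`, room `9Γ²s ≤ t₁`) is NOT quiet on the final window `[t₁ − s/32, t₁]`, then an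
ε-HOT EVENT sits within `r := Γ√s` of the annulus during the last `4r²` of time, at clock `≤ √5·r`.
Mechanism (contrapositive): (i) if `T'−t₁ > r²` every point of the window has clock `> r`, the rate gives
`|u| ≤ M/r ≤ M^{-3μ}/√s` and Kiselev–Ladyzhenskaya/KNSS interior smoothing the two derivative bounds once
`Γ ≥ C_j^{1/(j+1)} M^{1+3μ}` — no violation; (ii) else, if every `(y,t)` with `t₁−4r² ≤ t ≤ t₁`,
`R−r ≤ |y−x₀| ≤ M^{10μ}R+r` were ε-cold, then on each `Q_{r}(x,t₁)`, `x` in the annulus, the GKT `(∞,1)`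
quantity is `≤ 2ε` at every `ρ ≤ r/2` around every point [corpus:paper:arxiv-math_0607114 p.2 Thm 1.1(i),
region III: `p = ∞`, `1 ≤ q ≤ 2`, `ε` depends on `(p,q)` only]; GKT's local-energy iteration, SEEDED by the
tree's proved `ThinCascade.UniformScaledEnergy` (`stub_uniformScaledEnergy`: `A, E, D ≤ C(M)` at every
vertex and scale, from the rate alone — applied to the frame restricted to `[0,t]`, `frame_restrict` /
`typeI_restrict`), reaches the Caffarelli–Kohn–Nirenberg threshold after `O(log(C(M)/ε))` halvings, whence
`‖∇ʲu‖ ≤ C_j(M) r^{-(j+1)} ≤ M^{-3μ} s^{-(j+1)/2}` on the annulus × window for `Γ ≥ Γ(μ,M)` — no violation.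
Why it might fail: not as mathematics (each step is in print; the seed I1 is in the tree); porting cost M
(GKT's iteration with an explicit constant).  Sources: Gustafson–Kang–Tsai CMP 2007 (arXiv:math/0607114)
Thm 1.1; [CaffarelliKohnNirenberg1982]; I1 = `Theorems/QuarterLogPincerTypeIQuantSubcubicExpStubUniformScaledEnergy.lean`. -/
def HotWitness : Prop :=
  ∀ μ M ε₀ : ℝ, 0 < μ → 1 ≤ M → 0 < ε₀ → ∃ ε Γ : ℝ, 0 < ε ∧ ε ≤ ε₀ ∧ 1 ≤ Γ ∧
    ∀ (T τ : ℝ) (u : ℝ → (EuclideanSpace ℝ (Fin 3)) → (EuclideanSpace ℝ (Fin 3)))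
      (p : ℝ → (EuclideanSpace ℝ (Fin 3)) → ℝ),
      (IsClassicalNSSolutionOn (Icc 0 T) 1 0 u p ∧
          ∀ m : ℕ, ∃ C : NNReal, ∀ t ∈ Icc 0 T, eLpNorm (iteratedFDeriv ℝ m (u t)) 2 volume ≤ C) →
        0 < τ →
        (∀ t ∈ Icc 0 T, ∀ x : (EuclideanSpace ℝ (Fin 3)), ‖u t x‖ ≤ M * (T + τ - t) ^ (-(1 / 2 : ℝ))) →
        ∀ (a t₁ : ℝ) (x₀ : (EuclideanSpace ℝ (Fin 3))) (k : ℕ) (R : ℝ), t₁ ∈ Ioc 0 T →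
          9 * (Γ * Real.sqrt (levelScale a t₁ (k + 1))) ^ 2 ≤ t₁ →
          4 * M * Real.sqrt (levelScale a t₁ (k + 1)) ≤ R →
          M ^ (10 * μ) * R ≤ Real.exp a * Real.sqrt (levelScale a t₁ (k + 1)) →
          (¬ ∀ t ∈ Icc (t₁ - levelScale a t₁ (k + 1) / 32) t₁, ∀ x : (EuclideanSpace ℝ (Fin 3)),
              R < ‖x - x₀‖ → ‖x - x₀‖ < M ^ (10 * μ) * R → ∀ j : ℕ, j ≤ 2 →
                ‖iteratedFDeriv ℝ j (u t) x‖ ≤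
                  M ^ (-(3 * μ)) * (levelScale a t₁ (k + 1)) ^ (-(((j : ℝ) + 1) / 2))) →
          ∃ (y : (EuclideanSpace ℝ (Fin 3))) (t : ℝ), Hot ε (T + τ) u y t ∧ t ≤ t₁ ∧
            t₁ - 4 * (Γ * Real.sqrt (levelScale a t₁ (k + 1))) ^ 2 ≤ t ∧
            T + τ - t ≤ 5 * (Γ * Real.sqrt (levelScale a t₁ (k + 1))) ^ 2 ∧
            R - Γ * Real.sqrt (levelScale a t₁ (k + 1)) ≤ ‖y - x₀‖ ∧
            ‖y - x₀‖ ≤ M ^ (10 * μ) * R + Γ * Real.sqrt (levelScale a t₁ (k + 1))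

/-- **E1a — `HotWitnessFar`** (director-ns dss_141 (1): E1 := E1a ⊕ E1b; THE TREE'S THEOREM `hotWitness_far`, restated as
a Prop with `levelScale` folded — `stub_hotWitnessFar` below is `hotWitness_far` by `rfl`-unfolding, NO sorry).  Clock-far
case `(Γ√s)² < T'−t₁`: every point of `[0,t₁]` has clock `> r = Γ√s`, the rate is a GLOBAL speed bound `M/r`, and KNSS
smoothing of bounded classical solutions (`exists_norm_iteratedFDeriv_le_of_speed_le`) makes the annulus (indeed all of
space) quiet for `Γ ≥ Γ₀(μ,M)`; threshold quantified UPWARD (`∃ Γ₀, ∀ Γ ≥ Γ₀`) so that it recombines with any E1b by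
`Γ := max Γ₀ Γ₁` (ns-afl-r1 typed note 06:16Z). -/
def HotWitnessFar : Prop :=
  ∀ μ M : ℝ, 0 < μ → 1 ≤ M → ∃ Γ₀ : ℝ, 1 ≤ Γ₀ ∧ ∀ Γ : ℝ, Γ₀ ≤ Γ →
    ∀ (T τ : ℝ) (u : ℝ → (EuclideanSpace ℝ (Fin 3)) → (EuclideanSpace ℝ (Fin 3)))
      (p : ℝ → (EuclideanSpace ℝ (Fin 3)) → ℝ),
      (IsClassicalNSSolutionOn (Icc 0 T) 1 0 u p ∧
          ∀ m : ℕ, ∃ C : NNReal, ∀ t ∈ Icc 0 T, eLpNorm (iteratedFDeriv ℝ m (u t)) 2 volume ≤ C) →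
        0 < τ →
        (∀ t ∈ Icc 0 T, ∀ x : (EuclideanSpace ℝ (Fin 3)), ‖u t x‖ ≤ M * (T + τ - t) ^ (-(1 / 2 : ℝ))) →
        ∀ (a t₁ : ℝ) (x₀ : (EuclideanSpace ℝ (Fin 3))) (k : ℕ) (R : ℝ), t₁ ∈ Ioc 0 T →
          9 * (Γ * Real.sqrt (levelScale a t₁ (k + 1))) ^ 2 ≤ t₁ →
          4 * M * Real.sqrt (levelScale a t₁ (k + 1)) ≤ R →
          M ^ (10 * μ) * R ≤ Real.exp a * Real.sqrt (levelScale a t₁ (k + 1)) →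
          (Γ * Real.sqrt (levelScale a t₁ (k + 1))) ^ 2 < T + τ - t₁ →
          ∀ t ∈ Icc (t₁ - levelScale a t₁ (k + 1) / 32) t₁, ∀ x : (EuclideanSpace ℝ (Fin 3)),
            R < ‖x - x₀‖ → ‖x - x₀‖ < M ^ (10 * μ) * R → ∀ j : ℕ, j ≤ 2 →
              ‖iteratedFDeriv ℝ j (u t) x‖ ≤
                M ^ (-(3 * μ)) * (levelScale a t₁ (k + 1)) ^ (-(((j : ℝ) + 1) / 2))

/-- **E1b — `HotWitnessNear`** (director-ns dss_141 (1); afl-r1: `Γ` quantified upward, `ε` produced below any cap and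
BEFORE `Γ₁`).  For `μ > 0`, `M ≥ 1`, any cap `ε₀ > 0` there are `0 < ε = ε(M,ε₀) ≤ ε₀` and `Γ₁ = Γ₁(μ,M) ≥ 1` such that
for every `Γ ≥ Γ₁`, in the crux frame with virtual rate `M`: if a candidate annulus of level `k+1` (room `9Γ²s ≤ t₁`,
guards as in E1) is NOT quiet on the final window and the clock at `t₁` is NEAR, `T'−t₁ ≤ (Γ√s)²`, then an ε-HOT EVENT
`(y,t)` sits within `r := Γ√s` of the annulus during the last `4r²` of time, at clock `≤ √5·r`.  Mechanism
(contrapositive = «ε-cold cylinders are quantitatively regular», line `cold_smoothing`): if every `(y,t)` with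
`t₁−4r² ≤ t ≤ t₁`, `R−r ≤ |y−x₀| ≤ M^{10μ}R+r` is not hot then — the room clause `T'−t ≤ 5r² ≤ t₁−4r² ≤ t` being automatic
— it is ε-COLD, `√(T'−t)‖u(t,y)‖ ≤ ε`; for `x` in the annulus and `t' ∈ [t₁−s/32, t₁]` the cylinder `Q_r(x,t')` is cold, so
(i) the GKT `(∞,1)` quantity `G(ρ) = ρ⁻¹∫_{t'−ρ²}^{t'} sup_{B_ρ(x)}|u| ≤ ρ⁻¹ε∫(T'−t)^{-1/2}dt ≤ 2ε` at EVERY `ρ ≤ r`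
[corpus:paper:arxiv-math_0607114 p.2 Thm 1.1(i)]; (ii) `C(ρ) = ρ⁻²∬_{Q_ρ}|u|³ ≤ A(ρ)·G(ρ) ≤ 2εC(M)` with `A(ρ) ≤ C(M)`
the tree's PROVED I1 (`ThinCascade.stub_uniformScaledEnergy`, frame restricted to `[0,t']`, `frame_restrict` /
`typeI_restrict`); (iii) I1's pressure clause is `D(r; p̃) ≤ C(M)` for the gauge-shifted pressure `p̃ = p − ⨍_{B_r(x)}p(t)`
(still a pressure: `∇p̃ = ∇p`), and ONE step of the tree's PROVED pressure decay `D(θr; p̃) ≤ c(θD(r; p̃) + θ⁻²C(r))`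
(`seregin_sverak_pressure_decay_holds`, Seregin–Šverák 2009 (as13)) with `θ = θ(M) := ε⋆/(4cC(M))` and
`ε ≤ ε₁(M) := ε⋆θ²/(16(1+c)C(M))` gives `C(θr) + D(θr) < ε⋆`; (iv) the tree's PROVED higher ε-regularity
`seregin2014_lemma61_holds` (Seregin 2014 L.6.1 = NRŠ 1996 Prop. 2.1, absolute `c₀(j)`) on the `θr`-zoom
(`isSuitableWeakSolutionInBall_of_classical'`, `SpaceTimeRescaling`) yields `‖∇ʲu(t',x)‖ ≤ c₀(j)(θr/2)^{-(j+1)}`, i.e.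
`≤ M^{-3μ}s^{-(j+1)/2}` once `Γ ≥ Γ₁(μ,M) := 2·max_j (c₀(j)M^{3μ})^{1/(j+1)}/θ(M)` — no violation.  `ε` depends on `M`
(not on `μ`, `Γ`), which E1's quantifier order allows.  Why it might fail: not as mathematics (every step is a tree
theorem or Hölder); porting cost M (Fubini between I1's iterated integrals and `cknC`/`cknD`, the gauge shift, the zoom).
Sources: Gustafson–Kang–Tsai CMP 2007 (arXiv:math/0607114) Thm 1.1(i); [SereginSverak2009] (as13); [Seregin2014] L.6.1;
tree `PressureDecayEstimateProofs`, `SereginEpsilonRegularityHigherHolds`, `ClassicalTopPointCubic`,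
`QuarterLogPincerTypeIQuantSubcubicExpStubUniformScaledEnergy`. -/
def HotWitnessNear : Prop :=
  ∀ μ M ε₀ : ℝ, 0 < μ → 1 ≤ M → 0 < ε₀ → ∃ ε : ℝ, 0 < ε ∧ ε ≤ ε₀ ∧ ∃ Γ₁ : ℝ, 1 ≤ Γ₁ ∧ ∀ Γ : ℝ, Γ₁ ≤ Γ →
    ∀ (T τ : ℝ) (u : ℝ → (EuclideanSpace ℝ (Fin 3)) → (EuclideanSpace ℝ (Fin 3)))
      (p : ℝ → (EuclideanSpace ℝ (Fin 3)) → ℝ),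
      (IsClassicalNSSolutionOn (Icc 0 T) 1 0 u p ∧
          ∀ m : ℕ, ∃ C : NNReal, ∀ t ∈ Icc 0 T, eLpNorm (iteratedFDeriv ℝ m (u t)) 2 volume ≤ C) →
        0 < τ →
        (∀ t ∈ Icc 0 T, ∀ x : (EuclideanSpace ℝ (Fin 3)), ‖u t x‖ ≤ M * (T + τ - t) ^ (-(1 / 2 : ℝ))) →
        ∀ (a t₁ : ℝ) (x₀ : (EuclideanSpace ℝ (Fin 3))) (k : ℕ) (R : ℝ), t₁ ∈ Ioc 0 T →
          9 * (Γ * Real.sqrt (levelScale a t₁ (k + 1))) ^ 2 ≤ t₁ →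
          4 * M * Real.sqrt (levelScale a t₁ (k + 1)) ≤ R →
          M ^ (10 * μ) * R ≤ Real.exp a * Real.sqrt (levelScale a t₁ (k + 1)) →
          T + τ - t₁ ≤ (Γ * Real.sqrt (levelScale a t₁ (k + 1))) ^ 2 →
          (¬ ∀ t ∈ Icc (t₁ - levelScale a t₁ (k + 1) / 32) t₁, ∀ x : (EuclideanSpace ℝ (Fin 3)),
              R < ‖x - x₀‖ → ‖x - x₀‖ < M ^ (10 * μ) * R → ∀ j : ℕ, j ≤ 2 →
                ‖iteratedFDeriv ℝ j (u t) x‖ ≤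
                  M ^ (-(3 * μ)) * (levelScale a t₁ (k + 1)) ^ (-(((j : ℝ) + 1) / 2))) →
          ∃ (y : (EuclideanSpace ℝ (Fin 3))) (t : ℝ), Hot ε (T + τ) u y t ∧ t ≤ t₁ ∧
            t₁ - 4 * (Γ * Real.sqrt (levelScale a t₁ (k + 1))) ^ 2 ≤ t ∧
            T + τ - t ≤ 5 * (Γ * Real.sqrt (levelScale a t₁ (k + 1))) ^ 2 ∧
            R - Γ * Real.sqrt (levelScale a t₁ (k + 1)) ≤ ‖y - x₀‖ ∧
            ‖y - x₀‖ ≤ M ^ (10 * μ) * R + Γ * Real.sqrt (levelScale a t₁ (k + 1))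

/-- **E2♭ — `TerminalEmberM` (size L; THE LINE'S LOAD-BEARING LEMMA; no wall; `A`-free).**  As E2 `TerminalEmber`
(tree `…EmberCensusDefs`, mechanism (a)–(d) in its docstring: regular aftermath / vortical centre / cost of
silencing / readout) EXCEPT that the ε-regularity cap may depend on the rate: `∀ M ≥ 1, ∃ ε₁ = ε₁(M) > 0, ∀ 0 < ε ≤ ε₁,
∃ K c Λ`.  Why weaker suffices: K2 fixes `M` first, takes E2♭'s cap `ε₁(M)`, and asks E1 for a threshold `ε ≤ ε₁(M)`
(E1 produces one below ANY cap).  Why it matters: step (a) (regular aftermath, Sa of `silencing_cost`) is then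
reachable by ONE pressure-decay step with `ε ≤ ε₁(M)` (line `cold_smoothing`), instead of the Gustafson–Kang–Tsai
contraction needed for an `M`-uniform cap.  `TerminalEmber → TerminalEmberM` (`terminalEmberM_of_terminalEmber`).
Why it might fail / sources / killed by: as E2 (step (c), the thick-box silencing cost: Tao 2021 Prop. 4.3,
corpus:paper:tao2021-quantitative-bounds-critically-bounded-solutions-navier-stokes p.32; arXiv:math/0611462 Thm 2–3;
ESS backward uniqueness; a smooth Type-I family with a terminal ε-hot event whose box cube at `t₁` → 0 for every
fixed `K` kills it). -/
def TerminalEmberM : Prop :=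
  ∀ M : ℝ, 1 ≤ M → ∃ ε₁ : ℝ, 0 < ε₁ ∧ ∀ ε : ℝ, 0 < ε → ε ≤ ε₁ → ∃ K c Λ : ℝ, 1 ≤ K ∧ 0 < c ∧ 1 ≤ Λ ∧
    ∀ (T τ : ℝ) (u : ℝ → (EuclideanSpace ℝ (Fin 3)) → (EuclideanSpace ℝ (Fin 3)))
      (p : ℝ → (EuclideanSpace ℝ (Fin 3)) → ℝ),
      (IsClassicalNSSolutionOn (Icc 0 T) 1 0 u p ∧
          ∀ m : ℕ, ∃ C : NNReal, ∀ t ∈ Icc 0 T, eLpNorm (iteratedFDeriv ℝ m (u t)) 2 volume ≤ C) →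
        0 < τ →
        (∀ t ∈ Icc 0 T, ∀ x : (EuclideanSpace ℝ (Fin 3)), ‖u t x‖ ≤ M * (T + τ - t) ^ (-(1 / 2 : ℝ))) →
        ∀ (t₁ : ℝ) (y : (EuclideanSpace ℝ (Fin 3))) (t : ℝ), t₁ ∈ Ioc 0 T → t ≤ t₁ → Λ * (T + τ - t) ≤ t →
          Hot ε (T + τ) u y t → Terminal K ε (T + τ) t₁ u y t →
          ENNReal.ofReal c ≤ ∫⁻ x in ball y (K * Real.sqrt (T + τ - t)), ‖u t₁ x‖ₑ ^ (3 : ℝ)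

end SplitV12

end

end Summit.NavierStokesRegularity.NavierStokesRegularity.Cruxes.TypeIQuantSubcubicExp.EmberCensus
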